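import Summits.ValiantsHypothesis.ValiantsHypothesis.Theorems.KPlusLogSqLawWeakLiftingTowerGraftTwoSidedThreeLettersLaw
import Summits.ValiantsHypothesis.ValiantsHypothesis.Theorems.KPlusLogSqLawWeakLiftingTowerGraftTwoSidedClusteredUppers

/-!
# Tower graft line — the FOUR-LETTER two-sided word on CLUSTERED supports `(d₀, d₀+2g, d₀+3g, d₀+4g)`: `Z₊ ≤ 2m`
# (census currency; part G of the two-sided series)

Crux `stmt-ValiantsHypothesis-19561`, line (B) `tower_graft`, two-sided word instrument; seat val-sym-lift-p3 g20, `--supports 19561`,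
NO stub claimed.  Part F (`…TwoSidedClusteredUppers`) bounded the NEGATIVE-type (entering) roots of `P₀ + τ²J + τ³B + τ⁴C`
(`P₀, B, C ⪰ 0`, `J` ANY symmetric) by `rank P₀` through the clustered Gram certificate (Cauchy + rank one).  This file puts it in
the census currency `F(X) = ∑ₖ X^{dₖ}Sₖ`, `S = ![P₀, J, B, C]`, `d = ![d₀, d₀+2g, d₀+3g, d₀+4g]` (e.g. the support `(0,2,3,4)`):
`rayleigh_deriv_eq4` (`t·P_u′(t) = g·t^{d₀}·(τ³⟨u,Bu⟩ + 2τ⁴⟨u,Cu⟩ − 2⟨u,P₀u⟩)`, `τ = t^g`) and the headline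
★ `card_posRoots_le_two_mul_four_letters`: if `P₀ ≻ 0`, `C ≻ 0` and every positive root of `det F` is a SIMPLE CROSSING
(one-dimensional kernel, definite type), then `det F` has AT MOST `2m` positive roots counted with multiplicity — negative type
`≤ rank P₀ = m` and `N⁺ = N⁻` by the inertia kit's GLOBAL INDEX FORMULA (`ν(P₀) = ν(C) = 0`).  A FOUR-letter, all-`m`,
rank-charged sub-Descartes law; located maxima (this seat, exact): `4 = 2m` at `m = 2`, `6 = 2m` at `m = 3` on `(0,2,3,4)`; the
clustering is necessary in the data (`(0,2,3,5)`: `6 > 2m` at `m = 2`).  HONEST FRAMING: clustered supports, NOT towers (on an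
m-tower the upper gaps grow ×m and the certificate does not exist); nothing on the four-letter tower column (2·6·≥10·≥14), S4…S5,
`TowerB`, `WeakLifting` in its window, Conjecture B, 18050 or `VP ≠ VNP`.  Def-free; axioms standard.

[folklore] via parts A–C, F and the tree's inertia kit ([GohbergLancasterRodman2005, §12.4–12.5]).
-/

set_option linter.dupNamespace false
set_option autoImplicit false

namespace Summit.ValiantsHypothesis.ValiantsHypothesis.Theorems.KPlusLogSqLaw.TowerGraft

open Matrix
open scoped BigOperators

namespace TwoSidedThree

/-! ## §7 The FOUR-LETTER clustered word in census currency and its `2m` law -/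

section FourLetters

open Polynomial
open Summit.ValiantsHypothesis.ValiantsHypothesis.Theorems.LacunarySymmetroidMatrixDescartes

variable {m : ℕ}

/-- the four-letter pencil on `(d₀, d₀+2g, d₀+3g, d₀+4g)` evaluated at `t` is `t^{d₀}·(P₀ + τ²J + τ³B + τ⁴C)`, `τ = t^g`. [folklore] -/
theorem pencil4_eval (P₀ J B C : Matrix (Fin m) (Fin m) ℝ) (d₀ g : ℕ) (t : ℝ) :
    (∑ k : Fin 4, t ^ (![d₀, d₀ + 2 * g, d₀ + 3 * g, d₀ + 4 * g] k) • (![P₀, J, B, C] k))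
      = t ^ d₀ • (P₀ + (t ^ g) ^ 2 • J + (t ^ g) ^ 3 • B + (t ^ g) ^ 4 • C) := by
  rw [Fin.sum_univ_four]
  simp only [Matrix.cons_val_zero, Matrix.cons_val_one, Matrix.cons_val]
  rw [show (t ^ g) ^ 2 = t ^ (2 * g) by rw [Nat.mul_comm 2 g, pow_mul],
    show (t ^ g) ^ 3 = t ^ (3 * g) by rw [Nat.mul_comm 3 g, pow_mul],
    show (t ^ g) ^ 4 = t ^ (4 * g) by rw [Nat.mul_comm 4 g, pow_mul],
    smul_add, smul_add, smul_add, smul_smul, smul_smul, smul_smul, ← pow_add, ← pow_add, ← pow_add]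

/-- kernel vectors of the evaluated four-letter pencil are kernel vectors of the reduced pencil. [folklore] -/
theorem reduced_kernel4 (P₀ J B C : Matrix (Fin m) (Fin m) ℝ) (d₀ g : ℕ) {t : ℝ} (ht : 0 < t) (u : Fin m → ℝ)
    (hu : (∑ k : Fin 4, t ^ (![d₀, d₀ + 2 * g, d₀ + 3 * g, d₀ + 4 * g] k) • (![P₀, J, B, C] k)) *ᵥ u = 0) :
    (P₀ + (t ^ g) ^ 2 • J + (t ^ g) ^ 3 • B + (t ^ g) ^ 4 • C) *ᵥ u = 0 := by
  rw [pencil4_eval, Matrix.smul_mulVec] at hu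
  exact (smul_eq_zero.mp hu).resolve_left (pow_ne_zero _ (ne_of_gt ht))

/-- **type dictionary, four letters**: at a kernel vector `u` of the pencil at `t > 0`, with `τ = t^g`,
`t·P_u′(t) = g·t^{d₀}·(τ³⟨u,Bu⟩ + 2τ⁴⟨u,Cu⟩ − 2⟨u,P₀u⟩)`. [folklore] -/
theorem rayleigh_deriv_eq4 (P₀ J B C : Matrix (Fin m) (Fin m) ℝ) (d₀ g : ℕ) {t : ℝ} (ht : 0 < t) (u : Fin m → ℝ)
    (hu : (∑ k : Fin 4, t ^ (![d₀, d₀ + 2 * g, d₀ + 3 * g, d₀ + 4 * g] k) • (![P₀, J, B, C] k)) *ᵥ u = 0) :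
    t * (derivative (∑ k : Fin 4, Polynomial.C (u ⬝ᵥ ((![P₀, J, B, C] k) *ᵥ u)) *
        (X : ℝ[X]) ^ (![d₀, d₀ + 2 * g, d₀ + 3 * g, d₀ + 4 * g] k))).eval t
      = (g : ℝ) * t ^ d₀ * ((t ^ g) ^ 3 * (u ⬝ᵥ (B *ᵥ u)) + 2 * (t ^ g) ^ 4 * (u ⬝ᵥ (C *ᵥ u)) - 2 * (u ⬝ᵥ (P₀ *ᵥ u))) := by
  have hred := reduced_kernel4 P₀ J B C d₀ g ht u hu
  have hray : u ⬝ᵥ (P₀ *ᵥ u) + (t ^ g) ^ 2 * (u ⬝ᵥ (J *ᵥ u)) + (t ^ g) ^ 3 * (u ⬝ᵥ (B *ᵥ u))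
      + (t ^ g) ^ 4 * (u ⬝ᵥ (C *ᵥ u)) = 0 := by
    have h := congrArg (fun w => u ⬝ᵥ w) hred
    simp only [dotProduct_zero, Matrix.add_mulVec, Matrix.smul_mulVec, dotProduct_add, dotProduct_smul,
      smul_eq_mul] at h
    linarith
  rw [← Multiplicity.form_derivative_eq_eval]
  rw [Fin.sum_univ_four]
  simp only [Matrix.cons_val_zero, Matrix.cons_val_one, Matrix.cons_val, Matrix.add_mulVec, Matrix.smul_mulVec,
    dotProduct_add, dotProduct_smul, smul_eq_mul]
  have h0 := SecularRolle.mul_natCast_mul_pow_pred t d₀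
  have h1 := SecularRolle.mul_natCast_mul_pow_pred t (d₀ + 2 * g)
  have h2 := SecularRolle.mul_natCast_mul_pow_pred t (d₀ + 3 * g)
  have h3 := SecularRolle.mul_natCast_mul_pow_pred t (d₀ + 4 * g)
  rw [show t * (↑d₀ * t ^ (d₀ - 1) * (u ⬝ᵥ (P₀ *ᵥ u)) + ↑(d₀ + 2 * g) * t ^ (d₀ + 2 * g - 1) * (u ⬝ᵥ (J *ᵥ u))
        + ↑(d₀ + 3 * g) * t ^ (d₀ + 3 * g - 1) * (u ⬝ᵥ (B *ᵥ u)) + ↑(d₀ + 4 * g) * t ^ (d₀ + 4 * g - 1) * (u ⬝ᵥ (C *ᵥ u)))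
      = (t * (↑d₀ * t ^ (d₀ - 1))) * (u ⬝ᵥ (P₀ *ᵥ u)) + (t * (↑(d₀ + 2 * g) * t ^ (d₀ + 2 * g - 1))) * (u ⬝ᵥ (J *ᵥ u))
        + (t * (↑(d₀ + 3 * g) * t ^ (d₀ + 3 * g - 1))) * (u ⬝ᵥ (B *ᵥ u))
        + (t * (↑(d₀ + 4 * g) * t ^ (d₀ + 4 * g - 1))) * (u ⬝ᵥ (C *ᵥ u)) by ring, h0, h1, h2, h3]
  push_cast
  have e2 : t ^ (d₀ + 2 * g) = t ^ d₀ * (t ^ g) ^ 2 := by rw [pow_add, Nat.mul_comm 2 g, pow_mul]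
  have e3 : t ^ (d₀ + 3 * g) = t ^ d₀ * (t ^ g) ^ 3 := by rw [pow_add, Nat.mul_comm 3 g, pow_mul]
  have e4 : t ^ (d₀ + 4 * g) = t ^ d₀ * (t ^ g) ^ 4 := by rw [pow_add, Nat.mul_comm 4 g, pow_mul]
  have hJ : (t ^ g) ^ 2 * (u ⬝ᵥ (J *ᵥ u)) = -(u ⬝ᵥ (P₀ *ᵥ u)) - (t ^ g) ^ 3 * (u ⬝ᵥ (B *ᵥ u))
      - (t ^ g) ^ 4 * (u ⬝ᵥ (C *ᵥ u)) := by linarith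
  rw [e2, e3, e4]
  have h4 : (↑(d₀) + 2 * ↑g : ℝ) * (t ^ d₀ * (t ^ g) ^ 2) * (u ⬝ᵥ (J *ᵥ u))
      = (↑d₀ + 2 * ↑g) * t ^ d₀ * ((t ^ g) ^ 2 * (u ⬝ᵥ (J *ᵥ u))) := by ring
  rw [h4, hJ]
  ring

/-- **THE FOUR-LETTER `2m` LAW ON CLUSTERED SUPPORTS** (`(d₀, d₀+2g, d₀+3g, d₀+4g)`, e.g. `(0,2,3,4)`).  `P₀ ≻ 0`, `C ≻ 0`, `B ⪰ 0`,
`J` ANY symmetric, `g ≥ 1`, `F(X) = X^{d₀}P₀ + X^{d₀+2g}J + X^{d₀+3g}B + X^{d₀+4g}C`; if every positive root of `det F` is a SIMPLE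
CROSSING (one-dimensional kernel of definite type), then `det F` has at most `2m` positive roots counted with multiplicity: the
NEGATIVE-type roots are `≤ rank P₀ = m` (`card_negType_le_rank_four_letters`), and `N⁺ = N⁻` by `Inertia.global_index_formula`
(`ν(P₀) = ν(C) = 0`).  A sub-Descartes law for a FOUR-letter two-sided word, uniform in `m` (located maxima `4, 6 = 2m` at `m = 2, 3`).
[folklore] -/
theorem card_posRoots_le_two_mul_four_letters (P₀ J B C : Matrix (Fin m) (Fin m) ℝ) (hP₀ : P₀.PosDef) (hJ : J.IsSymm)
    (hB : B.PosSemidef) (hC : C.PosDef) (d₀ g : ℕ) (hg : 0 < g)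
    (hcorank : ∀ t : ℝ, 0 < t →
      (∑ k : Fin 4, t ^ (![d₀, d₀ + 2 * g, d₀ + 3 * g, d₀ + 4 * g] k) • (![P₀, J, B, C] k)).det = 0 →
      (∑ k : Fin 4, t ^ (![d₀, d₀ + 2 * g, d₀ + 3 * g, d₀ + 4 * g] k) • (![P₀, J, B, C] k)).rank + 1 = m)
    (htype : ∀ t : ℝ, 0 < t →
      (∑ k : Fin 4, t ^ (![d₀, d₀ + 2 * g, d₀ + 3 * g, d₀ + 4 * g] k) • (![P₀, J, B, C] k)).det = 0 →
      (∀ u : Fin m → ℝ, (∑ k : Fin 4, t ^ (![d₀, d₀ + 2 * g, d₀ + 3 * g, d₀ + 4 * g] k) • (![P₀, J, B, C] k)) *ᵥ u = 0 →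
        u ≠ 0 → (derivative (∑ k : Fin 4, Polynomial.C (u ⬝ᵥ ((![P₀, J, B, C] k) *ᵥ u)) *
          (X : ℝ[X]) ^ (![d₀, d₀ + 2 * g, d₀ + 3 * g, d₀ + 4 * g] k))).eval t < 0) ∨
      (∀ u : Fin m → ℝ, (∑ k : Fin 4, t ^ (![d₀, d₀ + 2 * g, d₀ + 3 * g, d₀ + 4 * g] k) • (![P₀, J, B, C] k)) *ᵥ u = 0 →
        u ≠ 0 → 0 < (derivative (∑ k : Fin 4, Polynomial.C (u ⬝ᵥ ((![P₀, J, B, C] k) *ᵥ u)) *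
          (X : ℝ[X]) ^ (![d₀, d₀ + 2 * g, d₀ + 3 * g, d₀ + 4 * g] k))).eval t)) :
    Multiset.card ((Matrix.det (∑ k : Fin 4, ((X : ℝ[X]) ^ (![d₀, d₀ + 2 * g, d₀ + 3 * g, d₀ + 4 * g] k)) •
      (![P₀, J, B, C] k).map Polynomial.C)).roots.filter (fun t => 0 < t)) ≤ 2 * m := by
  classical
  set dv : Fin 4 → ℕ := ![d₀, d₀ + 2 * g, d₀ + 3 * g, d₀ + 4 * g] with hdv
  set Sv : Fin 4 → Matrix (Fin m) (Fin m) ℝ := ![P₀, J, B, C] with hSv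
  have hP₀s : P₀.IsSymm := by
    have h1 := hP₀.1; unfold Matrix.IsHermitian at h1
    rwa [Matrix.conjTranspose_eq_transpose_of_trivial] at h1
  have hBs : B.IsSymm := by
    have h1 := hB.1; unfold Matrix.IsHermitian at h1
    rwa [Matrix.conjTranspose_eq_transpose_of_trivial] at h1
  have hCs : C.IsSymm := by
    have h1 := hC.1; unfold Matrix.IsHermitian at h1
    rwa [Matrix.conjTranspose_eq_transpose_of_trivial] at h1
  have hS : ∀ k, (Sv k).IsSymm := by
    intro k; fin_cases k
    · exact hP₀s
    · exact hJ
    · exact hBs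
    · exact hCs
  have hmin : ∀ l : Fin 4, l ≠ 0 → dv 0 < dv l := by
    intro l hl; fin_cases l
    · exact absurd rfl hl
    · show d₀ < d₀ + 2 * g; omega
    · show d₀ < d₀ + 3 * g; omega
    · show d₀ < d₀ + 4 * g; omega
  have hmax : ∀ l : Fin 4, l ≠ 3 → dv l < dv 3 := by
    intro l hl; fin_cases l
    · show d₀ < d₀ + 4 * g; omega
    · show d₀ + 2 * g < d₀ + 4 * g; omega
    · show d₀ + 3 * g < d₀ + 4 * g; omega
    · exact absurd rfl hl
  have h0 : (Sv 0).det ≠ 0 := by show P₀.det ≠ 0; exact hP₀.det_pos.ne'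
  have h3 : (Sv 3).det ≠ 0 := by show C.det ≠ 0; exact hC.det_pos.ne'
  let negType : ℝ → Prop := fun t => ∀ u : Fin m → ℝ, (∑ k, t ^ dv k • Sv k) *ᵥ u = 0 → u ≠ 0 →
    (derivative (∑ k, Polynomial.C (u ⬝ᵥ (Sv k *ᵥ u)) * (X : ℝ[X]) ^ dv k)).eval t < 0
  obtain ⟨hidx, -, hsum⟩ := Inertia.global_index_formula dv Sv hS 0 3 hmin hmax h0 h3 htype negType
    (fun t _ _ => Iff.rfl)
  have hν0 : Fintype.card {j // (Inertia.isHermitian_of_isSymm (hS 0)).eigenvalues j < 0} = 0 := by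
    rw [Fintype.card_eq_zero_iff]
    refine ⟨fun ⟨j, hj⟩ => ?_⟩
    have hp : 0 < (Inertia.isHermitian_of_isSymm (hS 0)).eigenvalues j := hP₀.eigenvalues_pos j
    linarith
  have hν3 : Fintype.card {j // (Inertia.isHermitian_of_isSymm (hS 3)).eigenvalues j < 0} = 0 := by
    rw [Fintype.card_eq_zero_iff]
    refine ⟨fun ⟨j, hj⟩ => ?_⟩
    have hp : 0 < (Inertia.isHermitian_of_isSymm (hS 3)).eigenvalues j := hC.eigenvalues_pos j
    linarith
  rw [hν0, hν3, zero_add, zero_add] at hidx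
  set P := Matrix.det (∑ k, ((X : ℝ[X]) ^ dv k) • (Sv k).map Polynomial.C) with hP
  have hdef : ∀ t : ℝ, 0 < t → (∑ k, t ^ dv k • Sv k).det = 0 → ∀ v : Fin m → ℝ, (∑ k, t ^ dv k • Sv k) *ᵥ v = 0 →
      v ≠ 0 → (derivative (∑ k, Polynomial.C (v ⬝ᵥ (Sv k *ᵥ v)) * (X : ℝ[X]) ^ dv k)).eval t ≠ 0 := by
    intro t ht hdet v hv hv0
    rcases htype t ht hdet with h | h
    · exact ne_of_lt (h v hv hv0)
    · exact ne_of_gt (h v hv hv0)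
  -- the NEGATIVE-type positive roots: a multiset without repetition
  set q : ℝ → Prop := fun t => 0 < t ∧ negType t with hq
  have hnodup : (P.roots.filter q).Nodup := by
    rw [Multiset.nodup_iff_count_le_one]
    intro a
    by_cases hqa : q a
    · rw [Multiset.count_filter_of_pos hqa, count_roots]
      by_cases hr : (∑ k, a ^ dv k • Sv k).det = 0
      · have h1 := Multiplicity.rootMultiplicity_det_pencil_eq_one dv Sv hS a
          (by rw [Fintype.card_fin]; exact hcorank a hqa.1 hr) (hdef a hqa.1 hr)
        rw [← hP] at h1
        omega
      · have hnr : ¬ P.IsRoot a := by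
          intro hroot
          apply hr
          have h1 : P.eval a = 0 := hroot
          rwa [hP, DefiniteMoments.eval_det_pencil] at h1
        rw [Polynomial.rootMultiplicity_eq_zero hnr]
        exact zero_le_one
    · rw [Multiset.count_filter_of_neg hqa]
      exact zero_le_one
  set T := (P.roots.filter q).toFinset with hTdef
  have hTcard : T.card = Multiset.card (P.roots.filter q) := Multiset.toFinset_card_of_nodup hnodup
  have hTpos : ∀ t ∈ T, 0 < t := fun t ht => (Multiset.mem_filter.mp (Multiset.mem_toFinset.mp ht)).2.1
  have hTroot : ∀ t ∈ T, ∃ u : Fin m → ℝ, (∑ k : Fin 4, t ^ (dv k) • (Sv k)) *ᵥ u = 0 ∧ u ≠ 0 ∧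
      (derivative (∑ k : Fin 4, Polynomial.C (u ⬝ᵥ ((Sv k) *ᵥ u)) * (X : ℝ[X]) ^ (dv k))).eval t < 0 := by
    intro t ht
    obtain ⟨hmem, htq⟩ := Multiset.mem_filter.mp (Multiset.mem_toFinset.mp ht)
    obtain ⟨hP0, hroot⟩ := (Polynomial.mem_roots').mp hmem
    have hdet : (∑ k, t ^ dv k • Sv k).det = 0 := by
      have h1 : P.eval t = 0 := hroot
      rwa [hP, DefiniteMoments.eval_det_pencil] at h1
    obtain ⟨u, hu0, hu⟩ := Matrix.exists_mulVec_eq_zero_iff.mpr hdet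
    exact ⟨u, hu, hu0, htq.2 u hu hu0⟩
  choose! u hu using hTroot
  have hTle : T.card ≤ P₀.rank := by
    have h := card_negType_le_rank_four_letters (I := T) P₀ J (fun t => ((t : ℝ)) ^ g) (fun t => u t) B C
      hP₀.posSemidef hJ hB hC.posSemidef (fun t => pow_pos (hTpos t t.2) g)
      (fun t t' htt' => Subtype.coe_injective
        ((pow_left_inj₀ (hTpos t t.2).le (hTpos t' t'.2).le (Nat.pos_iff_ne_zero.mp hg)).mp htt'))
      (fun t => reduced_kernel4 P₀ J B C d₀ g (hTpos t t.2) _ (hu t t.2).1) ?_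
    · simpa using h
    · intro t
      have ht := hTpos t t.2
      have hneg := (hu t t.2).2.2
      have heq := rayleigh_deriv_eq4 P₀ J B C d₀ g ht _ (hu t t.2).1
      have h1 : t * (derivative (∑ k : Fin 4, Polynomial.C (u t ⬝ᵥ ((![P₀, J, B, C] k) *ᵥ u t)) *
          (X : ℝ[X]) ^ (![d₀, d₀ + 2 * g, d₀ + 3 * g, d₀ + 4 * g] k))).eval (t : ℝ) < 0 :=
        mul_neg_of_pos_of_neg ht hneg
      rw [heq] at h1
      have h2 : 0 < (g : ℝ) * (t : ℝ) ^ d₀ := mul_pos (Nat.cast_pos.mpr hg) (pow_pos ht _)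
      by_contra hcon
      push Not at hcon
      have h3 : 0 ≤ ((t : ℝ) ^ g) ^ 3 * (u t ⬝ᵥ (B *ᵥ u t)) + 2 * ((t : ℝ) ^ g) ^ 4 * (u t ⬝ᵥ (C *ᵥ u t))
          - 2 * (u t ⬝ᵥ (P₀ *ᵥ u t)) := by linarith
      have := mul_nonneg h2.le h3
      linarith
  have hP₀m : P₀.rank ≤ m := (Matrix.rank_le_width P₀).trans le_rfl
  rw [← hsum]
  have hN : Multiset.card (P.roots.filter q) ≤ m := by rw [← hTcard]; exact hTle.trans hP₀m
  have hidx' : Multiset.card (P.roots.filter fun t => 0 < t ∧ ¬ negType t) = Multiset.card (P.roots.filter q) := hidx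
  rw [hidx']
  omega

end FourLetters

end TwoSidedThree

end Summit.ValiantsHypothesis.ValiantsHypothesis.Theorems.KPlusLogSqLaw.TowerGraft
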